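import Summits.CriticalPhenomena.PercolationContinuityZ3.Theorems.Transplant.SkelPhiConcFaceRun
import Summits.CriticalPhenomena.PercolationContinuityZ3.Theorems.Transplant.SkelSign2ParamsFace
import HarnessLib

/-!
# Residue (F) of route D″ v2 AT THE CHOICE FUNCTION OF RECORD: `PlanarSkeletonSign.faceHoldsRFn_signChoice₂ : FaceHoldsRFn signChoice₂`
# — the run-restricted face residue `Skelφ.FaceOblR` of the chosen two-unit scheme at every running density `q` with `AtQ`, as ONE call of
# `Skelφ.faceOblR_concS_kits` (SkelPhiConcFaceRun) fed by stmt-g9's parameter ledger (`SkelSign1Params2` = `signChoice₂`, the choice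
# function of record; `SkelSign2ParamsAtQ/AtQ2/Depth/Counts/Root/Corr/FaceVal/Face`: the face step's window/count/rows `face_levels_at/face_count_at/
# face_rows_at`, the accuracies `face_acc_at`, the gaps `face_gap_at`, the rim numerics `face_rim_at`, the first hop `face_first_at`, the
# (F) schedule of record `face_twoBand_at` (`FaceRun.TwoBandOKR`) with its fits `face_fit_at` and reach `face_reach_at`, the inner route rooms
# `face_inner_route_at`, the inner excess `face_inner_excess_at`, the chain property `inner_chain`, the kit block of `Skelφ.Prm`, the
# Step-I′ family `inputs_at` at accuracy `δI`)

builds on p205010 (kernel theorem, internal audit signed; external expert review pending) — nothing in this file uses p205010.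
Lane `prim-bschramm`, seat `prim-hp-8` (gen 30; (F) column of the D″ order of battle — its last file), helper file
(`--supports stmt-CriticalPhenomena-4575 --as helper`).  Division of labour (lead g5 07:27:00Z, p3-g7 07:35:37Z: ₂ of record): values +
facts stmt-g9's, the one call mine.
* **`PlanarSkeletonSign.faceHoldsRFn_signChoice₂`** — the (F) argument of `samePDropOfSkeletonSign₁_of_choiceFnRH signChoice₂ …`.
[cite: KozmaNitzan2024, §4 pp. 26–31 (Step III), Lemma 10 (pp. 17–22), Lemma 11 (pp. 22–23), Lemma 12 (pp. 23–25)]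
[cite: MartineauSevero2019, Cor. 2.2]
-/

noncomputable section

open scoped Classical

namespace Summit.CriticalPhenomena.PercolationContinuityZ3.Theorems.Transplant

namespace PlanarSkeletonSign

open MeasureTheory
open Literature.Probability.Percolation Literature.Probability.LatticeModels SimpleGraph
open Literature.Probability.Percolation.KozmaNitzan.Cells (oth oth_oth)
open SkelConc (Consts)
open ChainPlanar KNCells

/-- **THE (F) RESIDUE AT THE CHOICE FUNCTION OF RECORD**: for every handed constants `κ`, every admissible centred one-type sign skeleton and
every running density with `AtQ`, the run-restricted face obligations `Skelφ.FaceOblR` of the chosen scheme hold at accuracy `κ.δ₂`.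
[cite: KozmaNitzan2024, §4 pp. 26–31 (Step III), Lemma 11 (pp. 22–23), Lemma 12 (pp. 23–25)] -/
theorem faceHoldsRFn_signChoice₂ : FaceHoldsRFn signChoice₂ := by
  intro κ V _ _ G _ Φ hg t ht h1 h0 p hp0 hp1 hC O q hat
  change (Sgn₂.choiceAt κ Φ t p hC).AtQ O q at hat
  -- the chosen scheme is the two-unit scheme of record over `Sgn₂.cells` with the radii `concRadii2S cells gap 0 E₀ L′` (all by `rfl`)
  show Skelφ.FaceOblR G Φ.φ
    (⟨Skelφ.cellGeomSG G Φ.φ (Sgn₂.cells κ Φ p O) t (Skelφ.concRadii2S (Sgn₂.cells κ Φ p O) (Skelφ.Prm.gap (Sgn₂.schedIn κ Φ p O q))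
      (fun _ => 0) (Skelφ.Prm.E₀ (Sgn₂.schedIn κ Φ p O q)) (Skelφ.Prm.Lp (Sgn₂.schedIn κ Φ p O q))), q, κ.δ⟩ : KSchA V ℕ)
    (Skelφ.faceDataSG G Φ.φ (Sgn₂.cells κ Φ p O) t (Skelφ.concRadii2S (Sgn₂.cells κ Φ p O) (Skelφ.Prm.gap (Sgn₂.schedIn κ Φ p O q))
      (fun _ => 0) (Skelφ.Prm.E₀ (Sgn₂.schedIn κ Φ p O q)) (Skelφ.Prm.Lp (Sgn₂.schedIn κ Φ p O q)))) Φ.Δ κ.δ₂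
  -- the dictionary of the sign skeleton
  have hlip : Skelφ.Lip G Φ.φ := Φ.toPlanarSkeletonNeg.lip_skelφ
  have hstep : Skelφ.Steps G Φ.φ := Φ.toPlanarSkeletonNeg.steps_skelφ
  have hκ : Skelφ.CylConn G Φ.φ Φ.types := Φ.toPlanarSkeletonNeg.cylConn_skelφ
  -- `q ≤ p < 1` (the `q ≤ p` conjunct of `AtQ`, read by projection — independent of stmt-g9's lemma names)
  have hq1 : (q : ℝ) < 1 := lt_of_le_of_lt hat.2.2.2.2.1 hp1
  -- the Step-I′ family at `q` with accuracy `δI`, over the lists of record (index set at the one type `t`)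
  have hfam : ∀ i ∈ Skelφ.StepI.index Φ.types (Sgn.Sz O) (Sgn₂.Sx κ Φ p O) (Sgn₂.Sy κ Φ p O),
      1 - Sgn.δI κ Φ < (bondPercolation G q).real (Skelφ.StepI.event G Φ.φ O.D i) := by
    rw [h1]; exact Sgn₂.inputs_at hat
  have hRΛ := Sgn₂.R_Λ_eq hat
  have hacc := Sgn₂.face_acc_at (κ := κ) (Φ := Φ)
  have hlev := Sgn₂.face_levels_at (κ := κ) (Φ := Φ) (p := p) (O := O)
  have hcnt := Sgn₂.face_count_at hat hp0 hp1
  obtain ⟨hr₀₁, hr₀₂, -⟩ := Sgn₂.r₀_kit_at (κ := κ) (Φ := Φ) (p := p) (O := O)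
  refine Skelφ.faceOblR_concS_kits (types := Φ.types) hlip hstep Φ.frame hκ Φ.degree_le hC (D := O.D) (off := O.off) hRΛ.2
    (δI := Sgn.δI κ Φ) (δ₂ := κ.δ₂) (δA := Sgn.δkit κ Φ) hfam κ.hδ₂0 hacc.2.1 hacc.2.2.1 hacc.2.2.2.1 hacc.2.2.2.2.1
    -- (a) the face obligation's own data
    (Sgn₂.cells κ Φ p O) t (Skelφ.Prm.gap (Sgn₂.schedIn κ Φ p O q)) (fun _ => 0) (Skelφ.Prm.E₀ (Sgn₂.schedIn κ Φ p O q))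
    (Skelφ.Prm.Lp (Sgn₂.schedIn κ Φ p O q)) κ.δ (fun n => (Sgn₂.face_gap_at hat n).1) (fun n => (Sgn₂.face_gap_at hat n).2.1)
    (Sgn₂.face_gap_at hat 0).2.2.2.2.1 (Sgn₂.face_gap_at hat 0).2.2.2.2.2 h0 (Rlev := Sgn.Rlev κ Φ p O) (N := Sgn.NP κ Φ p O)
    (M := Sgn.T₀ O - 1) ⟨(Sgn₂.face_rows_at hat 0).1, (Sgn₂.face_rows_at hat 1).1⟩ ⟨(Sgn₂.face_rows_at hat 0).2, (Sgn₂.face_rows_at hat 1).2⟩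
    hcnt.1 (η := Sgn.η κ Φ) hacc.2.2.2.2.2.1 (fun ρ => Sgn₂.Rex κ Φ p O q (ρ + 1)) ?_ (fun ρ => (Sgn₂.face_gap_at hat ρ).2.2.1)
    -- (c) the kit block
    (Mz := Sgn.Mu O) (Sgn₂.mem_lists_at (κ := κ) (Φ := Φ) (p := p) (O := O)).1 (Sgn₂.Mu_facts hat).2.2.2
    (ℓK := Skelφ.Prm.ℓK (Sgn.Mu O)) (fun I _ => (Sgn₂.mem_lists_at (κ := κ) (Φ := Φ) (p := p) (O := O)).2.1)
    (fun I _ => (Sgn₂.mem_lists_at (κ := κ) (Φ := Φ) (p := p) (O := O)).2.2.1)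
    (A := Skelφ.Prm.A O.D (Sgn.Mu O)) (Rk := Skelφ.Prm.Rk O.D (Sgn.Mu O)) (Skelφ.Prm.hAw O.D (Sgn.Mu O)) (Skelφ.Prm.hRk O.D (Sgn.Mu O))
    (ℓs := Sgn.M O) (Mk := Sgn.M O) (K := Sgn.Kd O) (Rc := Sgn.Rseed Φ O) (r₀ := Sgn₂.r₀ κ Φ p O) (rs := Sgn.rs Φ O)
    (Skelφ.Prm.one_le_M O.D (Sgn.Mu O)) (Skelφ.Prm.hA O.D (Sgn.Mu O)) (Skelφ.Prm.hAℓ O.D (Sgn.Mu O))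
    (Skelφ.Prm.hK O.D (Sgn.Mu O) (Sgn.ρz O)) (Skelφ.Prm.hnA O.D (Sgn.Mu O)) (Skelφ.Prm.hnM O.D (Sgn.Mu O)) ?_
    (Skelφ.Prm.hR'₁ O.D (Sgn.Mu O) G Φ.φ Φ.types) (Skelφ.Prm.hR'₂ O.D (Sgn.Mu O) G Φ.φ Φ.types) hr₀₁ hr₀₂
    (Skelφ.Prm.hrs₁ O.D (Sgn.Mu O) G Φ.φ Φ.types (Sgn.ρz O)) (Skelφ.Prm.hrs₂ O.D (Sgn.Mu O) G Φ.φ Φ.types (Sgn.ρz O))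
    (cU := Sgn.cU Φ O) (Skelφ.Prm.hcU O.D (Sgn.Mu O) Φ.Δ) ?_
    -- (d) the face step's rooms and kit number
    hlev.1 (Sgn.kP κ Φ p O) hcnt.2.2.1 hcnt.2.1 (fun ρ => (Sgn₂.face_gap_at hat ρ).2.2.2.1)
    -- (e) rim numerics
    (L := Sgn₂.Lin κ Φ p O q) (L'' := Skelφ.Prm.Lp (Sgn₂.schedIn κ Φ p O q)) (fun i => (Sgn₂.face_rim_at hat i).2.2.2.2.1) le_rfl
    (Sgn₂.face_rim_at hat 0).2.2.2.2.2.1 (Sgn₂.face_rim_at hat 0).2.2.2.2.2.2.1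
    -- (f) the (F) schedule of record, per axis
    (fun i => Sgn₂.ℓ1 κ Φ p O i) (Sgn₂.face_first_at hat 0).1 (Sgn₂.face_first_at hat 0).2.1
    (a₁ := fun i => Skelφ.StepI.widths O.D.Gb O.D.Fb i (Sgn₂.ℓ1 κ Φ p O i)) (fun _ => rfl) (fun i i' => (Sgn₂.face_first_at hat i).2.2.1 i')
    (fun i => (Sgn₂.face_first_at hat i).2.2.2.1) (fun i => (Sgn₂.face_first_at hat i).2.2.2.2.1)
    (q'₁ := fun i => (Sgn₂.qR' κ Φ p O i : ℤ)) (s₁ := fun i => (Sgn₂.e κ Φ p O i : ℤ)) (ρ₁ := fun i => (Sgn₂.ρ₁N κ Φ p O i : ℤ))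
    (s₂ := fun i => (Sgn₂.sL κ Φ p O i : ℤ)) (ρ₂ := fun i => (Sgn₂.ρ₂N κ Φ p O i : ℤ)) (R'b := Sgn.R' κ Φ p O)
    (ℓ₀₁ := fun i => Sgn₂.ℓ₀ κ Φ p O i) (N₁ := fun _ => Sgn.L κ - 1) (WM₁ := fun i => Sgn₂.WMR κ Φ p O i) (ℓ₀₂ := fun i => Sgn₂.ℓ₀ κ Φ p O i)
    (WM₂ := fun i => Sgn₂.WMC κ Φ p O i) (ℓ₁₁ := fun i => Sgn₂.e κ Φ p O i + Sgn.R' κ Φ p O) (ℓ₁₂ := fun i => Sgn₂.ℓtop κ Φ p O i)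
    (Wb₁ := fun i => Sgn₂.WbR κ Φ p O i) (Wb₂ := fun i => Sgn₂.WbR κ Φ p O i) (fun i lv => Sgn₂.N₂F κ Φ p O i lv)
    (fun i lv => (Sgn₂.face_twoBand_at hat i lv).1) (fun i => (Sgn₂.face_twoBand_at hat i 0).2.1) (fun i => (Sgn₂.face_twoBand_at hat i 0).2.2)
    (fun i => (Sgn₂.face_first_at hat i).2.2.2.2.2.1) (fun i => (Sgn₂.face_first_at hat i).2.2.2.2.2.2)
    (fun du j hj lv cbo h₁ h₂ h₃ => Sgn₂.face_fit_at hat du j hj lv cbo h₁ h₂ h₃) (fun i lv => (Sgn₂.face_reach_at hat i lv).1)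
    (nmax := Skelφ.Prm.nmax (Sgn.A κ)) (fun i lv => (Sgn₂.face_reach_at hat i lv).2)
    -- (g) the inner chain
    (RlevA := Sgn.Rlev κ Φ p O) (NA := Sgn.NP κ Φ p O) (j₀A := Sgn.T₀ O) (j₁A := Sgn.Rlev κ Φ p O) (Lr := Sgn₂.r₀ κ Φ p O)
    (R₁A := Sgn₂.R₁A κ Φ p O q) (ηA := Sgn.η κ Φ) hlev.2.2.1 le_rfl le_rfl hacc.2.2.2.2.2.2 hcnt.2.2.2.1 le_rfl
    (Sgn₂.face_inner_excess_at hat).1 (Sgn₂.face_inner_excess_at hat).2 (fun i => (Sgn₂.face_inner_route_at hat i).1)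
    (fun i => (Sgn₂.face_inner_route_at hat i).2.1) (fun i => (Sgn₂.face_inner_route_at hat i).2.2.1)
    (fun i => (Sgn₂.face_inner_route_at hat i).2.2.2) (Sgn.kP κ Φ p O) hcnt.2.2.1 hcnt.2.2.2.2
    (fun c n hn => Sgn₂.inner_chain κ Φ n hn hq1 (Skel.winGraph G c (Sgn₂.Lin κ Φ p O q)) (Skel.winGraph_le G c _))
  · -- the excess radius at the root, planar diameter `50·rmax ≤ 60·rmax`, entrance depth `ρ + 1`
    intro ρ R₁ hR Rw D' A' hD hbox hA' hA
    exact Sgn₂.hRex_at_le hat (ρ + 1) (m := 50 * (Sgn₂.cells κ Φ p O).rmax) (by omega) le_rfl t R₁ hR Rw D' A' hD hbox hA' hA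
  · -- the zone room of the kit: `ψ Mu + off = ρz`
    intro i
    have := Skelφ.Prm.hρK O.D (Sgn.Mu O) (Sgn.ρz O) i
    rw [← hRΛ.1]
    exact this
  · -- `A i i ≤ Rk i`: `A i i = Mu + 1 ≤ amax (A i) ≤ ψ (amax (A i)) = Rk i`
    intro i
    rw [Skelφ.Prm.hRk, hRΛ.1]
    exact (Skelφ.le_amax _ i).trans (Skelφ.le_fatRadius Φ.frame hC _)

end PlanarSkeletonSign

end Summit.CriticalPhenomena.PercolationContinuityZ3.Theorems.Transplant

end
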